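import Literature.RingTheory.CompleteLocalRings.TeichmullerRepresentatives
import Literature.NumberTheory.GaloisRepresentations.LubinTateUnitBallIntegralClosure
import Literature.NumberTheory.GaloisRepresentations.LubinTateColemanRelativeTildeTwo
import Literature.NumberTheory.GaloisRepresentations.LubinTateColemanRelativeBaseNormLawsTwo
import Literature.NumberTheory.GaloisRepresentations.LubinTateColemanRelativeContinuousTwo
import Literature.NumberTheory.GaloisRepresentations.LubinTateColemanUnitsImageEquivTwo
import HarnessLib

/-!
# The principal projection `𝒰 → 𝒰¹`, `β ↦ ⟨β⟩ = β·ω(β)⁻¹`, of norm-coherent units along the Lubin–Tate towers `E·K_π^{m+1}`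
# (Teichmüller decomposition `𝒪_Eˣ = μ' × U¹` levelwise; it commutes with norms, Galois and products)

De Shalit, *Iwasawa theory of elliptic curves with complex multiplication* (1987), Ch. I §3.8 (16)–(17), Ch. III §1.3: the Coleman map `i`
is defined on `𝒰 ⊗̂ ℤ_p`, i.e. on the PRINCIPAL units `𝒰¹ = lim← U¹` — the prime-to-`p` torsion (Teichmüller part) of `𝒰 = lim← 𝒪(k_n)ˣ` dies.
The tree's two-variable Coleman module theory (`principalCoherentFamilies`, `colemanImageEquiv : 𝒰¹_∞ ≃ N`, the `char`-identities of
`Summit…ColemanCoinvariantChar*`) is accordingly stated for principal families, while the elliptic units `β(𝔞) = (e_n(𝔞))_n` are units but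
not principal units.  THIS file supplies the canonical projection (Serre, *Local Fields* II §4 Prop. 8: `x = ω(x)·⟨x⟩`):

* §1 the unit ball `𝒪_E` of a finite `E ⊆ F̄`: `unitBall_isUnit_iff_norm_eq_one`, `unitBall_mem_maximalIdeal_iff_norm_lt_one`, ★ `exists_isTeichmullerRep_unitBall`
  (every unit has a Teichmüller representative: `𝒪_E` is Henselian at `(π)` — `(π)`-adically complete — and `𝒪_E/π𝒪_E` is finite,
  `Literature.RingTheory.CompleteLocalRings.exists_isTeichmullerRep`); `coe_principalPart_toUnitBallHom`, `coe_principalPart_inclUnitBall`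
  (automorphisms and inclusions commute with `⟨·⟩`), `coe_principalPart_prod`;
* §2 ★ `inclusion_towerNorm_coe_principalPart` — **`N_{E₂/E₁}⟨x⟩ = ⟨N_{E₂/E₁} x⟩`** (`E₂/F` Galois; the norm is the product of the conjugates);
* §3 ★★ `RelNormCoherentUnits.principalPart β` — **`⟨β⟩ := (⟨β_m⟩)_m ∈ 𝒰(E·K_π^∞)`** and its laws: `coe_val_principalPart`,
  ★ `norm_val_principalPart_sub_one_lt_one` (PRINCIPAL at every level), `principalPart_mul`, `principalPart_one`, `principalPart_inv`,
  `principalPart_galAct` (`⟨σ̃β⟩ = σ̃⟨β⟩`), `principalPart_baseNorm` (`⟨N_{E₂/E₁}β⟩ = N_{E₂/E₁}⟨β⟩`), `principalPart_eq_self` (principal `β`);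
* §4 ★★ `principalPart_mem_principalCoherentFamilies` — for a baseNorm-coherent family `β = (β_m)_m` along an unramified tower `E_m`,
  **`(⟨β_m⟩)_m ∈ principalCoherentFamilies`**; `baseNormCoherent_principalPart`.

Everything PROVED (0 sorry, no named facts); one definition (`RelNormCoherentUnits.principalPart`).

## References
* E. de Shalit, *Iwasawa theory of elliptic curves with complex multiplication* (1987), Ch. I §3.8 (16)–(17); Ch. III §1.3. [deShalit1987]
* J.-P. Serre, *Local Fields* (1979), Ch. II §4 Prop. 8; Ch. IV §1. [SerreLocalFields1979]
-/

noncomputable section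

namespace Literature.NumberTheory.GaloisRepresentations

section PrincipalPart

open GaloisRepresentations.IsNonarchimedeanLocalField LubinTate ValuativeRel Field IsLocalRing
open Literature.RingTheory.CompleteLocalRings

variable {F : Type} [Field F] [ValuativeRel F] [TopologicalSpace F] [IsNonarchimedeanLocalField F]

attribute [local instance] ltNormUniformSpace ltNormIsUniformAddGroup rk1 nF nE fintypeResidueField

variable {π : 𝒪[F]} (hπ : (valuation F).IsUniformizer (π : F))

/-! ### §1. Units, the maximal ideal and Teichmüller representatives in `𝒪_E` -/

section UnitBall

variable (E : IntermediateField F (AlgebraicClosure F)) [FiniteDimensional F E]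

/-- `x ∈ 𝒪_E` is a unit iff `‖x‖ = 1`. [cite: SerreLocalFields1979, Ch. II §4] -/
theorem unitBall_isUnit_iff_norm_eq_one (x : unitBall E) : IsUnit x ↔ ‖(x : E)‖ = 1 := by
  rw [Valuation.Integers.isUnit_iff_valuation_eq_one (Valuation.integer.integers (NormedField.valuation (K := E))),
    show algebraMap (unitBall E) E x = (x : E) from rfl, NormedField.valuation_apply, ← NNReal.coe_eq_one, coe_nnnorm]

/-- `x ∈ 𝔪_{𝒪_E}` iff `‖x‖ < 1`. [cite: SerreLocalFields1979, Ch. II §4] -/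
theorem unitBall_mem_maximalIdeal_iff_norm_lt_one (x : unitBall E) : x ∈ maximalIdeal (unitBall E) ↔ ‖(x : E)‖ < 1 := by
  rw [IsLocalRing.mem_maximalIdeal, mem_nonunits_iff, unitBall_isUnit_iff_norm_eq_one]
  have hx : ‖(x : E)‖ ≤ 1 := (mem_unitBall_iff E).mp x.2
  exact ⟨fun h => lt_of_le_of_ne hx h, fun h => h.ne⟩

include hπ in
/-- `𝒪_E` is Henselian at `π𝒪_E` (it is `(π)`-adically complete). [cite: SerreLocalFields1979, Ch. II §4 Prop. 7] -/
theorem henselianRing_unitBall_span_pi : HenselianRing (unitBall E) (Ideal.span {algebraMap 𝒪[F] (unitBall E) π}) := by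
  haveI := isAdicComplete_span_algebraMap_pi hπ E
  infer_instance

include hπ in
/-- `𝒪_E/π𝒪_E` is finite (`|𝒪_E/π𝒪_E| = q^{[E:F]}`). [cite: SerreLocalFields1979, Ch. II §2 Prop. 3] -/
theorem finite_quotient_unitBall_span_pi [Algebra.IsSeparable F E] :
    Finite (unitBall E ⧸ Ideal.span {algebraMap 𝒪[F] (unitBall E) π}) := by
  apply Nat.finite_of_card_ne_zero
  rw [natCard_quotient_span_pi E hπ]
  exact pow_ne_zero _ (residueFieldCard_ne_zero F)

include hπ in
/-- The residue characteristic `p = char 𝓀[F]` lies in `π𝒪_E`. [cite: SerreLocalFields1979, Ch. II §4] -/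
theorem natCast_ringChar_mem_span_pi :
    ((ringChar 𝓀[F] : ℕ) : unitBall E) ∈ Ideal.span {algebraMap 𝒪[F] (unitBall E) π} := by
  have hp : ((ringChar 𝓀[F] : ℕ) : 𝒪[F]) ∈ 𝓂[F] := by
    rw [← IsLocalRing.residue_eq_zero_iff, map_natCast]
    exact ringChar.Nat.cast_ringChar
  obtain ⟨c, hc⟩ := dvd_of_mem_maximalIdeal F hπ hp
  rw [← map_natCast (algebraMap 𝒪[F] (unitBall E)), hc, map_mul]
  exact Ideal.mul_mem_right _ _ (Ideal.mem_span_singleton_self _)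

include hπ in
/-- ★ **Every unit of `𝒪_E` has a Teichmüller representative** (`E ⊆ F̄` finite separable over the local field `F`).
[cite: SerreLocalFields1979, Ch. II §4 Prop. 8] -/
theorem exists_isTeichmullerRep_unitBall [Algebra.IsSeparable F E] {x : unitBall E} (hx : ‖(x : E)‖ = 1) :
    ∃ ζ : unitBall E, IsTeichmullerRep ζ x := by
  haveI := henselianRing_unitBall_span_pi hπ E
  haveI := finite_quotient_unitBall_span_pi hπ E
  exact exists_isTeichmullerRep (Ideal.span {algebraMap 𝒪[F] (unitBall E) π})
    (CharP.char_is_prime 𝓀[F] (ringChar 𝓀[F])) (natCast_ringChar_mem_span_pi hπ E) ((unitBall_isUnit_iff_norm_eq_one E x).mpr hx)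

include hπ in
/-- ★ **`‖⟨x⟩ − 1‖ < 1`**: the principal part of a unit is a principal unit. [cite: SerreLocalFields1979, Ch. II §4 Prop. 8] -/
theorem norm_principalPart_sub_one_lt_one [Algebra.IsSeparable F E] {x : unitBall E} (hx : ‖(x : E)‖ = 1) :
    ‖((principalPart x : unitBall E) : E) - 1‖ < 1 := by
  have h := (unitBall_mem_maximalIdeal_iff_norm_lt_one E _).mp (principalPart_sub_one_mem (exists_isTeichmullerRep_unitBall hπ E hx))
  rwa [AddSubgroupClass.coe_sub, OneMemClass.coe_one] at h

/-- `‖⟨x⟩‖ = 1` for a unit `x`. [cite: SerreLocalFields1979, Ch. II §4 Prop. 8] -/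
theorem norm_principalPart_eq_one {x : unitBall E} (hx : ‖(x : E)‖ = 1) : ‖((principalPart x : unitBall E) : E)‖ = 1 :=
  (unitBall_isUnit_iff_norm_eq_one E _).mp (isUnit_principalPart ((unitBall_isUnit_iff_norm_eq_one E x).mpr hx))

include hπ in
/-- **Automorphisms commute with `⟨·⟩`**: `σ⟨x⟩ = ⟨σ x⟩` (`σ` preserves `‖·‖`, hence `𝔪`). [cite: SerreLocalFields1979, Ch. II §4 Prop. 8] -/
theorem coe_principalPart_toUnitBallHom [Algebra.IsSeparable F E] (σ : E ≃ₐ[F] E) {x : unitBall E} (hx : ‖(x : E)‖ = 1) :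
    ((principalPart (toUnitBallHom σ x) : unitBall E) : E) = σ ((principalPart x : unitBall E) : E) := by
  have h := map_principalPart (toUnitBallHom σ).toRingHom (fun a ha => by
    rw [unitBall_mem_maximalIdeal_iff_norm_lt_one] at ha ⊢
    change ‖((toUnitBallHom σ a : unitBall E) : E)‖ < 1
    rwa [coe_toUnitBallHom, norm_algEquiv]) (exists_isTeichmullerRep_unitBall hπ E hx)
  change (toUnitBallHom σ) (principalPart x) = principalPart (toUnitBallHom σ x) at h
  rw [← h, coe_toUnitBallHom]

variable {E} in
include hπ in
/-- **Inclusions commute with `⟨·⟩`**: for `E ≤ E'`, `⟨x⟩` computed in `𝒪_E` or in `𝒪_{E'}` agree. [cite: SerreLocalFields1979, Ch. II §4 Prop. 8] -/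
theorem coe_principalPart_inclUnitBall [Algebra.IsSeparable F E] {E' : IntermediateField F (AlgebraicClosure F)} [FiniteDimensional F E']
    (h : E ≤ E') {x : unitBall E} (hx : ‖(x : E)‖ = 1) :
    (((principalPart (inclUnitBall (F := F) h x) : unitBall E') : E') : AlgebraicClosure F) =
      (((principalPart x : unitBall E) : E) : AlgebraicClosure F) := by
  have hmap := map_principalPart (inclUnitBall (F := F) h).toRingHom (fun a ha => by
    rw [unitBall_mem_maximalIdeal_iff_norm_lt_one] at ha ⊢
    change ‖((inclUnitBall (F := F) h a : unitBall E') : E')‖ < 1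
    rwa [coe_inclUnitBall, norm_inclusion]) (exists_isTeichmullerRep_unitBall hπ E hx)
  change (inclUnitBall (F := F) h) (principalPart x) = principalPart (inclUnitBall (F := F) h x) at hmap
  rw [← hmap, coe_inclUnitBall, IntermediateField.coe_inclusion]

include hπ in
/-- `⟨∏ x_i⟩ = ∏ ⟨x_i⟩` for units `x_i`. [cite: SerreLocalFields1979, Ch. II §4 Prop. 8] -/
theorem principalPart_prod [Algebra.IsSeparable F E] {ι : Type*} (s : Finset ι) (f : ι → unitBall E)
    (hf : ∀ i ∈ s, ‖((f i : unitBall E) : E)‖ = 1) :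
    (principalPart (∏ i ∈ s, f i) : unitBall E) = ∏ i ∈ s, principalPart (f i) := by
  classical
  induction s using Finset.induction_on with
  | empty => rw [Finset.prod_empty, Finset.prod_empty, principalPart_one]
  | @insert a s ha ih =>
    have hfa : ‖((f a : unitBall E) : E)‖ = 1 := hf a (Finset.mem_insert_self a s)
    have hfs : ∀ i ∈ s, ‖((f i : unitBall E) : E)‖ = 1 := fun i hi => hf i (Finset.mem_insert_of_mem hi)
    have hprod : ‖((∏ i ∈ s, f i : unitBall E) : E)‖ = 1 := by
      rw [SubmonoidClass.coe_finsetProd, norm_prod]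
      exact Finset.prod_eq_one fun i hi => hfs i hi
    rw [Finset.prod_insert ha, Finset.prod_insert ha,
      principalPart_mul (exists_isTeichmullerRep_unitBall hπ E hfa) (exists_isTeichmullerRep_unitBall hπ E hprod), ih hfs]

end UnitBall

/-! ### §2. The relative norm commutes with the principal part -/

section TowerNorm

variable {E₁ E₂ : IntermediateField F (AlgebraicClosure F)} [FiniteDimensional F E₁] [FiniteDimensional F E₂] [IsGalois F E₂]

include hπ in
/-- ★ **`N_{E₂/E₁}⟨x⟩ = ⟨N_{E₂/E₁} x⟩`** for a unit `x ∈ 𝒪_{E₂}`, `E₁ ≤ E₂`, `E₂/F` Galois: `ι(N⟨x⟩) = ∏_σ σ⟨x⟩ = ∏_σ ⟨σx⟩ = ⟨∏_σ σx⟩ = ⟨ι(Nx)⟩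
= ι⟨Nx⟩` (both sides read in `E₂`). [cite: SerreLocalFields1979, Ch. II §4 Prop. 8, Ch. II §2] [cite: deShalit1987, Ch. I §2.2] -/
theorem inclusion_towerNorm_coe_principalPart [Algebra.IsSeparable F E₁] [Algebra.IsSeparable F E₂] (h : E₁ ≤ E₂) {x : unitBall E₂}
    (hx : ‖(x : E₂)‖ = 1) :
    IntermediateField.inclusion h (@Algebra.norm E₁ E₂ _ _ (towerAlgebra h) ((principalPart x : unitBall E₂) : E₂)) =
      ((principalPart (⟨IntermediateField.inclusion h (@Algebra.norm E₁ E₂ _ _ (towerAlgebra h) (x : E₂)), by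
          rw [mem_unitBall_iff, norm_inclusion, norm_towerNorm_eq_one h hx]⟩ : unitBall E₂) : unitBall E₂) : E₂) := by
  classical
  rw [algebraMap_towerNorm_eq_prod h]
  -- each conjugate: `σ⟨x⟩ = ⟨σx⟩`
  have h1 : ∏ σ ∈ Finset.univ.filter (fun σ : E₂ ≃ₐ[F] E₂ =>
        ∀ y : E₁, σ (IntermediateField.inclusion h y) = IntermediateField.inclusion h y),
        σ ((principalPart x : unitBall E₂) : E₂) =
      ((∏ σ ∈ Finset.univ.filter (fun σ : E₂ ≃ₐ[F] E₂ =>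
        ∀ y : E₁, σ (IntermediateField.inclusion h y) = IntermediateField.inclusion h y),
          (principalPart (toUnitBallHom σ x) : unitBall E₂) : unitBall E₂) : E₂) := by
    rw [SubmonoidClass.coe_finsetProd]
    exact Finset.prod_congr rfl fun σ _ => (coe_principalPart_toUnitBallHom hπ E₂ σ hx).symm
  rw [h1, ← principalPart_prod hπ E₂ _ _ (fun σ _ => by rw [coe_toUnitBallHom, norm_algEquiv, hx])]
  have h2 : (∏ σ ∈ Finset.univ.filter (fun σ : E₂ ≃ₐ[F] E₂ =>
        ∀ y : E₁, σ (IntermediateField.inclusion h y) = IntermediateField.inclusion h y), toUnitBallHom σ x : unitBall E₂) =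
      ⟨IntermediateField.inclusion h (@Algebra.norm E₁ E₂ _ _ (towerAlgebra h) (x : E₂)), by
          rw [mem_unitBall_iff, norm_inclusion, norm_towerNorm_eq_one h hx]⟩ := by
    apply Subtype.ext
    rw [SubmonoidClass.coe_finsetProd]
    change _ = IntermediateField.inclusion h (@Algebra.norm E₁ E₂ _ _ (towerAlgebra h) (x : E₂))
    rw [algebraMap_towerNorm_eq_prod h]
    exact Finset.prod_congr rfl fun σ _ => coe_toUnitBallHom σ x
  rw [h2]

end TowerNorm

/-! ### §3. The principal projection of norm-coherent units -/

section Coherent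

variable (E : IntermediateField F (AlgebraicClosure F)) [FiniteDimensional F E] [IsGalois F E] [CharZero F]

namespace RelNormCoherentUnits

variable {hπ E}

/-- ★★ **`⟨β⟩ := (⟨β_m⟩)_m`** — the principal projection of a norm-coherent unit along `E·K_π^{m+1}`: levelwise principal parts,
norm-coherent because the relative norms commute with `⟨·⟩` (§2). [cite: deShalit1987, Ch. I §3.8 (16)–(17)] [cite: SerreLocalFields1979, Ch. II §4 Prop. 8] -/
def principalPart (β : RelNormCoherentUnits hπ E) : RelNormCoherentUnits hπ E where
  val m := Literature.RingTheory.CompleteLocalRings.principalPart (β.val m)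
  norm_eq_one m := by
    haveI : FiniteDimensional F (E ⊔ ltField π m : IntermediateField F (AlgebraicClosure F)) :=
      IntermediateField.finiteDimensional_sup E (ltField π m)
    exact norm_principalPart_eq_one _ (β.norm_eq_one m)
  coherent n m hnm := by
    haveI : ∀ k, FiniteDimensional F (E ⊔ ltField π k : IntermediateField F (AlgebraicClosure F)) := fun k =>
      IntermediateField.finiteDimensional_sup E (ltField π k)
    haveI := isGalois_sup_ltField hπ E m
    have hle : (E ⊔ ltField π n : IntermediateField F (AlgebraicClosure F)) ≤ E ⊔ ltField π m :=
      sup_le_sup_left (ltField_mono hπ hnm) E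
    apply IntermediateField.inclusion_injective hle
    -- `ι(N⟨β_m⟩) = ⟨ι(Nβ_m)⟩ = ⟨ι β_n⟩ = ι⟨β_n⟩`
    have key : (⟨IntermediateField.inclusion hle (@Algebra.norm _ _ _ _ (towerAlgebra hle)
          ((β.val m : unitBall (E ⊔ ltField π m : IntermediateField F (AlgebraicClosure F))) :
            (E ⊔ ltField π m : IntermediateField F (AlgebraicClosure F)))), by
          rw [mem_unitBall_iff, norm_inclusion, norm_towerNorm_eq_one hle (β.norm_eq_one m)]⟩ :
          unitBall (E ⊔ ltField π m : IntermediateField F (AlgebraicClosure F))) = inclUnitBall (F := F) hle (β.val n) :=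
      Subtype.ext (by rw [coe_inclUnitBall]; change IntermediateField.inclusion hle _ = _; rw [β.coherent n m hnm])
    refine (inclusion_towerNorm_coe_principalPart hπ hle (β.norm_eq_one m)).trans ?_
    rw [key]
    apply Subtype.ext
    rw [IntermediateField.coe_inclusion]
    exact coe_principalPart_inclUnitBall hπ hle (β.norm_eq_one n)

/-- Components of `⟨β⟩` (unfolding). [cite: deShalit1987, Ch. I §3.8 (16)] -/
theorem val_principalPart (β : RelNormCoherentUnits hπ E) (m : ℕ) :
    β.principalPart.val m = Literature.RingTheory.CompleteLocalRings.principalPart (β.val m) := rfl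

/-- ★ **`⟨β⟩` is PRINCIPAL at every level**: `‖⟨β⟩_m − 1‖ < 1`. [cite: deShalit1987, Ch. I §3.8 (16)–(17)] [cite: SerreLocalFields1979, Ch. II §4 Prop. 8] -/
theorem norm_val_principalPart_sub_one_lt_one (β : RelNormCoherentUnits hπ E) (m : ℕ) :
    ‖((β.principalPart.val m : unitBall (E ⊔ ltField π m : IntermediateField F (AlgebraicClosure F))) :
        (E ⊔ ltField π m : IntermediateField F (AlgebraicClosure F))) - 1‖ < 1 := by
  haveI : FiniteDimensional F (E ⊔ ltField π m : IntermediateField F (AlgebraicClosure F)) :=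
    IntermediateField.finiteDimensional_sup E (ltField π m)
  exact norm_principalPart_sub_one_lt_one hπ _ (β.norm_eq_one m)

/-- `⟨ββ'⟩ = ⟨β⟩⟨β'⟩`. [cite: SerreLocalFields1979, Ch. II §4 Prop. 8] -/
theorem principalPart_mul (β β' : RelNormCoherentUnits hπ E) : (β.mul β').principalPart = β.principalPart.mul β'.principalPart := by
  refine RelNormCoherentUnits.ext fun m => ?_
  haveI : FiniteDimensional F (E ⊔ ltField π m : IntermediateField F (AlgebraicClosure F)) :=
    IntermediateField.finiteDimensional_sup E (ltField π m)
  rw [val_principalPart, val_mul, val_mul, val_principalPart, val_principalPart]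
  exact Literature.RingTheory.CompleteLocalRings.principalPart_mul (exists_isTeichmullerRep_unitBall hπ _ (β.norm_eq_one m))
    (exists_isTeichmullerRep_unitBall hπ _ (β'.norm_eq_one m))

/-- `⟨1⟩ = 1`. [cite: SerreLocalFields1979, Ch. II §4 Prop. 8] -/
theorem principalPart_one : (one : RelNormCoherentUnits hπ E).principalPart = one :=
  RelNormCoherentUnits.ext fun m => by rw [val_principalPart, val_one]; exact Literature.RingTheory.CompleteLocalRings.principalPart_one

/-- `⟨β⁻¹⟩ = ⟨β⟩⁻¹`. [cite: SerreLocalFields1979, Ch. II §4 Prop. 8] -/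
theorem principalPart_inv (β : RelNormCoherentUnits hπ E) : (β.inv hπ E).principalPart = β.principalPart.inv hπ E := by
  have h1 : (β.inv hπ E).mul β = one := RelNormCoherentUnits.ext fun m => Subtype.ext (by
    rw [val_mul, val_one, Subring.coe_mul, OneMemClass.coe_one]
    exact inv_mul_cancel₀ (β.coe_val_ne_zero hπ E m))
  have h2 : (β.principalPart.inv hπ E).mul β.principalPart = one := RelNormCoherentUnits.ext fun m => Subtype.ext (by
    rw [val_mul, val_one, Subring.coe_mul, OneMemClass.coe_one]
    exact inv_mul_cancel₀ (β.principalPart.coe_val_ne_zero hπ E m))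
  have h3 : ((β.inv hπ E).principalPart.mul β.principalPart) = one := by rw [← principalPart_mul, h1, principalPart_one]
  -- cancel `β.principalPart` on the right (componentwise, in a field)
  refine RelNormCoherentUnits.ext fun m => Subtype.ext ?_
  have e3 := congrArg (fun γ : RelNormCoherentUnits hπ E => ((γ.val m : unitBall (E ⊔ ltField π m : IntermediateField F
    (AlgebraicClosure F))) : (E ⊔ ltField π m : IntermediateField F (AlgebraicClosure F)))) (h3.trans h2.symm)
  simp only [val_mul, Subring.coe_mul] at e3
  exact mul_right_cancel₀ (β.principalPart.coe_val_ne_zero hπ E m) e3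

/-- **`⟨σ̃·β⟩ = σ̃·⟨β⟩`** for `σ̃ ∈ Γ_F`. [cite: deShalit1987, Ch. I §3.4 Lemma (ii)] [cite: SerreLocalFields1979, Ch. II §4 Prop. 8] -/
theorem principalPart_galAct (σ : absoluteGaloisGroup F) (β : RelNormCoherentUnits hπ E) :
    (β.galAct σ).principalPart = β.principalPart.galAct σ := by
  refine RelNormCoherentUnits.ext fun m => Subtype.ext ?_
  haveI : FiniteDimensional F (E ⊔ ltField π m : IntermediateField F (AlgebraicClosure F)) :=
    IntermediateField.finiteDimensional_sup E (ltField π m)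
  rw [val_principalPart, coe_val_galAct, val_principalPart]
  exact coe_principalPart_toUnitBallHom hπ _ (relRestrict hπ E m σ) (β.norm_eq_one m)

/-- `⟨β⟩ = β` for a principal `β` (`‖β_m − 1‖ < 1` at every level). [cite: SerreLocalFields1979, Ch. IV §1] -/
theorem principalPart_eq_self (β : RelNormCoherentUnits hπ E)
    (hβ : ∀ m, ‖((β.val m : unitBall (E ⊔ ltField π m : IntermediateField F (AlgebraicClosure F))) :
      (E ⊔ ltField π m : IntermediateField F (AlgebraicClosure F))) - 1‖ < 1) :
    β.principalPart = β := by
  refine RelNormCoherentUnits.ext fun m => ?_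
  haveI : FiniteDimensional F (E ⊔ ltField π m : IntermediateField F (AlgebraicClosure F)) :=
    IntermediateField.finiteDimensional_sup E (ltField π m)
  rw [val_principalPart]
  refine principalPart_eq_self_of_sub_one_mem ((unitBall_mem_maximalIdeal_iff_norm_lt_one _ _).mpr ?_)
  rw [AddSubgroupClass.coe_sub, OneMemClass.coe_one]
  exact hβ m

/-- `⟨⟨β⟩⟩ = ⟨β⟩`. [cite: SerreLocalFields1979, Ch. II §4 Prop. 8] -/
theorem principalPart_principalPart (β : RelNormCoherentUnits hπ E) : β.principalPart.principalPart = β.principalPart :=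
  principalPart_eq_self _ (norm_val_principalPart_sub_one_lt_one β)

end RelNormCoherentUnits

/-- ★ **`⟨N_{E₂/E₁} β⟩ = N_{E₂/E₁}⟨β⟩`**: the principal projection commutes with the norm down the unramified base.
[cite: deShalit1987, Ch. I §3.8 (16); Ch. III §1.2 Lemma (ii)] [cite: SerreLocalFields1979, Ch. II §4 Prop. 8] -/
theorem RelNormCoherentUnits.principalPart_baseNorm {E₁ E₂ : IntermediateField F (AlgebraicClosure F)} [FiniteDimensional F E₁]
    [FiniteDimensional F E₂] [IsGalois F E₁] [IsGalois F E₂] (h : E₁ ≤ E₂) (β : RelNormCoherentUnits hπ E₂) :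
    (β.baseNorm hπ h).principalPart = β.principalPart.baseNorm hπ h := by
  refine RelNormCoherentUnits.ext fun m => ?_
  haveI : ∀ E' : IntermediateField F (AlgebraicClosure F), ∀ [FiniteDimensional F E'],
      FiniteDimensional F (E' ⊔ ltField π m : IntermediateField F (AlgebraicClosure F)) := fun E' _ =>
    IntermediateField.finiteDimensional_sup E' (ltField π m)
  haveI := isGalois_sup_ltField hπ E₂ m
  have hle : (E₁ ⊔ ltField π m : IntermediateField F (AlgebraicClosure F)) ≤ E₂ ⊔ ltField π m := sup_le_sup_right h (ltField π m)
  apply Subtype.ext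
  apply IntermediateField.inclusion_injective hle
  -- right-hand side: `ι(N⟨β_m⟩) = ⟨ι(N β_m)⟩`
  rw [val_principalPart, coe_val_baseNorm, val_principalPart, inclusion_towerNorm_coe_principalPart hπ hle (β.norm_eq_one m)]
  -- left-hand side: `ι⟨(Nβ)_m⟩ = ⟨ι (Nβ)_m⟩`, and `ι (Nβ)_m = ι(N β_m)` as elements of `𝒪`
  have key : inclUnitBall (F := F) hle ((β.baseNorm hπ h).val m) =
      (⟨IntermediateField.inclusion hle (@Algebra.norm _ _ _ _ (towerAlgebra hle)
          ((β.val m : unitBall (E₂ ⊔ ltField π m : IntermediateField F (AlgebraicClosure F))) :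
            (E₂ ⊔ ltField π m : IntermediateField F (AlgebraicClosure F)))), by
          rw [mem_unitBall_iff, norm_inclusion, norm_towerNorm_eq_one hle (β.norm_eq_one m)]⟩ :
          unitBall (E₂ ⊔ ltField π m : IntermediateField F (AlgebraicClosure F))) :=
    Subtype.ext (by rw [coe_inclUnitBall, coe_val_baseNorm])
  rw [← key]
  apply Subtype.ext
  rw [IntermediateField.coe_inclusion]
  exact (coe_principalPart_inclUnitBall hπ hle ((β.baseNorm hπ h).norm_eq_one m)).symm

end Coherent

/-! ### §4. Principal projection of baseNorm-coherent families: `𝒰_∞ → 𝒰¹_∞` -/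

section Families

variable [CharZero F]
variable (E : ℕ → IntermediateField F (AlgebraicClosure F)) [∀ m, FiniteDimensional F (E m)] [∀ m, IsGalois F (E m)] (hmono : Monotone E)

/-- **BaseNorm-coherence is preserved**: `N_{E_{m+1}/E_m}⟨β_{m+1}⟩ = ⟨β_m⟩`. [cite: deShalit1987, Ch. I §3.8 (16); Ch. III §1.3] -/
theorem baseNormCoherent_principalPart {β : ∀ m, RelNormCoherentUnits hπ (E m)}
    (hβ : ∀ m, (β (m + 1)).baseNorm hπ (hmono (Nat.le_succ m)) = β m) (m : ℕ) :
    ((β (m + 1)).principalPart).baseNorm hπ (hmono (Nat.le_succ m)) = (β m).principalPart := by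
  rw [← RelNormCoherentUnits.principalPart_baseNorm, hβ m]

/-- ★★ **`(⟨β_m⟩)_m ∈ principalCoherentFamilies`** for every baseNorm-coherent family `β = (β_m)_m` of norm-coherent units along the
two-variable tower `E_m·K_π^{k+1}` — the principal projection `𝒰_∞ → 𝒰¹_∞` onto the domain of the two-variable Coleman map.
[cite: deShalit1987, Ch. I §3.8 (16)–(17); Ch. III §1.3] [cite: SerreLocalFields1979, Ch. II §4 Prop. 8] -/
theorem principalPart_mem_principalCoherentFamilies {β : ∀ m, RelNormCoherentUnits hπ (E m)}
    (hβ : ∀ m, (β (m + 1)).baseNorm hπ (hmono (Nat.le_succ m)) = β m) :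
    (fun m => (β m).principalPart) ∈ principalCoherentFamilies hπ E hmono :=
  ⟨fun m => baseNormCoherent_principalPart hπ E hmono hβ m, fun m => (β m).norm_val_principalPart_sub_one_lt_one 0⟩

end Families

end PrincipalPart

end Literature.NumberTheory.GaloisRepresentations

end
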